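import Mathlib.Analysis.MeanInequalities
import Mathlib.Analysis.SpecialFunctions.Log.Deriv
import Literature.MathematicalPhysics.StatisticalMechanics.IsothermalEquationsOfState
import Literature.MathematicalPhysics.StatisticalMechanics.MurnaghanVolumeConvexity
import HarnessLib

/-!
# Axial (linear) compressibilities and the volume compressibility of a crystal

The pressure tables of anisotropic superconductors print, next to the volume compressibility
`κ_V ≡ -V(0)⁻¹ (dV/dP)` and the bulk modulus `B ≡ κ_V⁻¹`
[cite: SchillingKlotz1992, §II.A (text before Table 1; chunks p0039–p0040 of the held scan)], the
compressibility COMPONENTS along the crystal axes, `κ_a ≡ -d ln a/dP`, `κ_b ≡ -d ln b/dP`,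
`κ_c ≡ -d ln c/dP` [cite: SchillingKlotz1992, §II.B (chunks p0042–p0043), Table 1].  For an
orthorhombic (tetragonal, hexagonal, cubic) cell the volume is `V = a b c` (`a² c`, `(√3/2) a² c`,
`a³`), so the logarithmic derivative is additive and, at every pressure,

  `κ_V = κ_a + κ_b + κ_c`   (tetragonal / hexagonal: `κ_V = 2 κ_a + κ_c`; cubic: `κ_V = 3 κ_a`)

— the identity the He-gas rows of Table 1 of the cited chapter obey (La₁.₈₅Sr₀.₁₅CuO₄:
`2.29 + 2.29 + 2.21 = 6.79`; YBa₂Cu₃O₆.₉₃: `2.22 + 1.65 + 4.26 = 8.13`, in `10⁻³ GPa⁻¹`)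
[cite: SchillingKlotz1992, §II.B Table 1 (elementary consequence)].  This file types and PROVES:

* `compressibilityOf f P = -(deriv f P)/(f P)` — ONE definition serving the axial (`f = a, b, c`)
  and the volume (`f = V`) compressibility at pressure `P`; `compressibilityOf_eq_neg_deriv_log`
  (it is `-d ln f/dP` where `f P ≠ 0`);
* the calculus of logarithmic derivatives: `compressibilityOf_mul`, `compressibilityOf_pow`,
  `compressibilityOf_const_mul`;
* the cell identities `compressibilityOf_orthorhombic` (`κ_V = κ_a + κ_b + κ_c`),
  `compressibilityOf_tetragonal` (`2κ_a + κ_c`), `compressibilityOf_hexagonal` (the constant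
  `√3/2` drops out), `compressibilityOf_cubic` (`3κ_a`);
* the worked EOS instance `compressibilityOf_murnaghanVolume`: along the Murnaghan isotherm
  `V(P) = V₀(1 + B₀'P/B₀)^{-1/B₀'}` one has `κ_V(P) = 1/(B₀ + B₀' P)` — the reciprocal of
  Murnaghan's linear bulk modulus [cite: Poirier1991, §4.2 eqs. (4.4)–(4.5)];
* two FINITE-COMPRESSION reading rules for printed axial ratios `u = a₁/a₀`, `v = b₁/b₀`,
  `w = c₁/c₀` (exact algebra, no smallness assumption): `axialSum_le_volumeRatio_sub_one_of_le_one`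
  — under compression (`u, v, w ≤ 1`, `0 ≤ w`) the SUM of the fractional axial changes is at most the
  fractional volume change, `(u-1)+(v-1)+(w-1) ≤ uvw - 1` (the linear sum OVERSTATES the volume
  loss; e.g. `3 × (-1.6 %) = -4.8 %` vs `0.984³ - 1 = -4.72 %` for the 0→10 GPa chord of
  La₂CuO₄ in Table 2 of the cited chapter), the same inequality under expansion
  (`axialSum_le_volumeRatio_sub_one_of_one_le`), and `cubeRoot_volumeRatio_le_mean_axialRatio` —
  the isotropic-equivalent linear ratio `(uvw)^{1/3}` is at most the mean axial ratio `(u+v+w)/3`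
  (AM–GM) [cite: HardyLittlewoodPolya1952, §2.5 Thm 9 (chunk p0020 of the held reprint)].

Everything here is PROVED; there are no named facts.  Not here: compressibilities of monoclinic /
triclinic cells (the direction-dependent linear compressibility `β = S_ijkk l_i l_j` of the
compliance tensor), and temperature derivatives.
-/

namespace Literature.MathematicalPhysics.StatisticalMechanics

noncomputable section

open Real Set

/-! ## The definition and the logarithmic-derivative calculus -/

/-- The (isothermal) compressibility at pressure `P` of a positive structural quantity `f(P)` —
a lattice parameter (`κ_a ≡ -d ln a/dP`) or the cell volume (`κ_V ≡ -V⁻¹ dV/dP`, bulk modulus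
`B = κ_V⁻¹`): `κ_f(P) = -f'(P)/f(P)`.
[cite: SchillingKlotz1992, §II.A–§II.B (definitions of `κ_V`, `B`, `κ_a`, `κ_b`, `κ_c`)] -/
def compressibilityOf (f : ℝ → ℝ) (P : ℝ) : ℝ := -(deriv f P) / f P

/-- Unfolding lemma: `κ_f(P) = -f'(P)/f(P)`.
[cite: SchillingKlotz1992, §II.A–§II.B (definitions of `κ_V`, `κ_a`, `κ_b`, `κ_c`)] -/
theorem compressibilityOf_def (f : ℝ → ℝ) (P : ℝ) :
    compressibilityOf f P = -(deriv f P) / f P := rfl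

/-- `κ_f = -d ln f/dP` wherever `f` is differentiable and nonzero.
[cite: SchillingKlotz1992, §II.B (`κ_a ≡ -d ln a/dP`)] -/
theorem compressibilityOf_eq_neg_deriv_log {f : ℝ → ℝ} {P : ℝ} (hf : DifferentiableAt ℝ f P)
    (h0 : f P ≠ 0) : compressibilityOf f P = -deriv (fun Q => Real.log (f Q)) P := by
  rw [compressibilityOf, deriv.log hf h0, neg_div]

/-- If `f` has derivative `f'` at `P` then `κ_f(P) = -f'/f(P)`.
[cite: SchillingKlotz1992, §II.A (`κ_V ≡ -V(0)⁻¹ (dV/dP)`; elementary consequence)] -/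
theorem compressibilityOf_eq_of_hasDerivAt {f : ℝ → ℝ} {f' P : ℝ} (hf : HasDerivAt f f' P) :
    compressibilityOf f P = -f' / f P := by
  rw [compressibilityOf, hf.deriv]

/-- Additivity under products: `κ_{fg} = κ_f + κ_g`.
[cite: SchillingKlotz1992, §II.B Table 1 (elementary consequence)] -/
theorem compressibilityOf_mul {f g : ℝ → ℝ} {P : ℝ} (hf : DifferentiableAt ℝ f P)
    (hg : DifferentiableAt ℝ g P) (hf0 : f P ≠ 0) (hg0 : g P ≠ 0) :
    compressibilityOf (fun Q => f Q * g Q) P = compressibilityOf f P + compressibilityOf g P := by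
  simp only [compressibilityOf]
  rw [deriv_fun_mul hf hg]
  field_simp
  ring

/-- Powers: `κ_{f^n} = n κ_f`.
[cite: SchillingKlotz1992, §II.B Table 1 (elementary consequence)] -/
theorem compressibilityOf_pow {f : ℝ → ℝ} {P : ℝ} (hf : DifferentiableAt ℝ f P) (hf0 : f P ≠ 0)
    (n : ℕ) : compressibilityOf (fun Q => f Q ^ n) P = n * compressibilityOf f P := by
  rw [compressibilityOf_eq_neg_deriv_log (hf.fun_pow n) (pow_ne_zero n hf0),
    compressibilityOf_eq_neg_deriv_log hf hf0]
  have hfun : (fun Q => Real.log (f Q ^ n)) = fun Q => (n : ℝ) * Real.log (f Q) :=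
    funext fun Q => Real.log_pow (f Q) n
  rw [hfun, deriv_const_mul _ (hf.log hf0)]
  ring

/-- A nonzero constant prefactor does not change the compressibility: `κ_{c f} = κ_f`.
[cite: SchillingKlotz1992, §II.B Table 1 (elementary consequence)] -/
theorem compressibilityOf_const_mul {f : ℝ → ℝ} {P : ℝ} (hf : DifferentiableAt ℝ f P)
    {c : ℝ} (hc : c ≠ 0) :
    compressibilityOf (fun Q => c * f Q) P = compressibilityOf f P := by
  simp only [compressibilityOf]
  rw [deriv_const_mul c hf]
  by_cases hf0 : f P = 0
  · simp [hf0]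
  · field_simp

/-! ## Cell identities -/

/-- ORTHORHOMBIC cell `V = a b c`: `κ_V = κ_a + κ_b + κ_c` at every pressure where the three
lattice parameters are differentiable and nonzero.
[cite: SchillingKlotz1992, §II.B Table 1 (elementary consequence; the He-gas rows obey it)] -/
theorem compressibilityOf_orthorhombic {a b c : ℝ → ℝ} {P : ℝ} (ha : DifferentiableAt ℝ a P)
    (hb : DifferentiableAt ℝ b P) (hc : DifferentiableAt ℝ c P) (ha0 : a P ≠ 0) (hb0 : b P ≠ 0)
    (hc0 : c P ≠ 0) :
    compressibilityOf (fun Q => a Q * b Q * c Q) P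
      = compressibilityOf a P + compressibilityOf b P + compressibilityOf c P := by
  rw [compressibilityOf_mul (ha.fun_mul hb) hc (mul_ne_zero ha0 hb0) hc0,
    compressibilityOf_mul ha hb ha0 hb0]

/-- TETRAGONAL cell `V = a² c`: `κ_V = 2 κ_a + κ_c`.
[cite: SchillingKlotz1992, §II.B Table 1 (elementary consequence; rows (t))] -/
theorem compressibilityOf_tetragonal {a c : ℝ → ℝ} {P : ℝ} (ha : DifferentiableAt ℝ a P)
    (hc : DifferentiableAt ℝ c P) (ha0 : a P ≠ 0) (hc0 : c P ≠ 0) :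
    compressibilityOf (fun Q => a Q ^ 2 * c Q) P
      = 2 * compressibilityOf a P + compressibilityOf c P := by
  rw [compressibilityOf_mul (ha.fun_pow 2) hc (pow_ne_zero 2 ha0) hc0,
    compressibilityOf_pow ha ha0 2]
  push_cast
  ring

/-- HEXAGONAL cell `V = (√3/2) a² c`: the constant drops out, `κ_V = 2 κ_a + κ_c`.
[cite: SchillingKlotz1992, §II.B Table 1 (elementary consequence)] -/
theorem compressibilityOf_hexagonal {a c : ℝ → ℝ} {P : ℝ} (ha : DifferentiableAt ℝ a P)
    (hc : DifferentiableAt ℝ c P) (ha0 : a P ≠ 0) (hc0 : c P ≠ 0) :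
    compressibilityOf (fun Q => Real.sqrt 3 / 2 * (a Q ^ 2 * c Q)) P
      = 2 * compressibilityOf a P + compressibilityOf c P := by
  have hk : Real.sqrt 3 / 2 ≠ 0 := by positivity
  rw [compressibilityOf_const_mul ((ha.fun_pow 2).fun_mul hc) hk]
  exact compressibilityOf_tetragonal ha hc ha0 hc0

/-- CUBIC cell `V = a³`: `κ_V = 3 κ_a`.
[cite: SchillingKlotz1992, §II.B Table 1 (elementary consequence)] -/
theorem compressibilityOf_cubic {a : ℝ → ℝ} {P : ℝ} (ha : DifferentiableAt ℝ a P)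
    (ha0 : a P ≠ 0) :
    compressibilityOf (fun Q => a Q ^ 3) P = 3 * compressibilityOf a P := by
  rw [compressibilityOf_pow ha ha0 3]
  push_cast
  ring

/-! ## The Murnaghan isotherm as the worked instance -/

/-- Along the Murnaghan isotherm `V(P) = V₀ (1 + B₀' P/B₀)^{-1/B₀'}` (`V₀, B₀, B₀' > 0`,
`P ≥ 0`) the volume compressibility is `κ_V(P) = 1/(B₀ + B₀' P)`, the reciprocal of Murnaghan's
linear bulk modulus `K(P) = B₀ + B₀' P`.
[cite: Poirier1991, §4.2 eqs. (4.4)–(4.5) (elementary consequence)] -/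
theorem compressibilityOf_murnaghanVolume {V₀ B₀ B₀' P : ℝ} (hV₀ : 0 < V₀) (hB₀ : 0 < B₀)
    (hB : 0 < B₀') (hP : 0 ≤ P) :
    compressibilityOf (fun Q => murnaghanVolume V₀ B₀ B₀' Q) P = 1 / (B₀ + B₀' * P) := by
  have hder := hasDerivAt_murnaghanVolume (V₀ := V₀) hB₀ hB hP
  rw [compressibilityOf_eq_of_hasDerivAt hder]
  have hy : 0 < 1 + B₀' * P / B₀ := by positivity
  have hV : murnaghanVolume V₀ B₀ B₀' P ≠ 0 := (murnaghanVolume_pos hV₀ hy).ne'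
  have hK : B₀ + B₀' * P ≠ 0 := by positivity
  field_simp

/-! ## Finite-compression reading rules for printed axial ratios -/

/-- COMPRESSION: for axial ratios `u = a₁/a₀ ≤ 1`, `v = b₁/b₀ ≤ 1`, `0 ≤ w = c₁/c₀ ≤ 1` the sum
of the fractional axial changes is at most the fractional volume change,
`(u - 1) + (v - 1) + (w - 1) ≤ u v w - 1` — i.e. adding printed axial contractions OVERSTATES the
volume contraction (exactly: `uvw - 1 - Σ(uᵢ - 1) = xy(1+z) + z(x+y) ≥ 0` with `x = u-1`,
`y = v-1`, `z = w-1`; only the nonnegativity of ONE ratio is needed).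
[cite: SchillingKlotz1992, §II.B Table 2 (chord 0→10 GPa columns; elementary consequence)] -/
theorem axialSum_le_volumeRatio_sub_one_of_le_one {u v w : ℝ} (hw : 0 ≤ w) (hu1 : u ≤ 1)
    (hv1 : v ≤ 1) (hw1 : w ≤ 1) :
    (u - 1) + (v - 1) + (w - 1) ≤ u * v * w - 1 := by
  nlinarith [mul_nonneg (sub_nonneg.2 hu1) (sub_nonneg.2 hv1),
    mul_nonneg (mul_nonneg (sub_nonneg.2 hu1) (sub_nonneg.2 hv1)) hw,
    mul_nonneg (sub_nonneg.2 hw1) (sub_nonneg.2 hu1),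
    mul_nonneg (sub_nonneg.2 hw1) (sub_nonneg.2 hv1)]

/-- EXPANSION: the same inequality when all three axial ratios are `≥ 1`.
[cite: SchillingKlotz1992, §II.B Table 2 (elementary consequence)] -/
theorem axialSum_le_volumeRatio_sub_one_of_one_le {u v w : ℝ} (hu1 : 1 ≤ u) (hv1 : 1 ≤ v)
    (hw1 : 1 ≤ w) :
    (u - 1) + (v - 1) + (w - 1) ≤ u * v * w - 1 := by
  nlinarith [mul_nonneg (sub_nonneg.2 hu1) (sub_nonneg.2 hv1),
    mul_nonneg (mul_nonneg (sub_nonneg.2 hu1) (sub_nonneg.2 hv1)) (sub_nonneg.2 hw1),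
    mul_nonneg (sub_nonneg.2 hw1) (sub_nonneg.2 hu1), mul_nonneg (sub_nonneg.2 hw1) (sub_nonneg.2 hv1)]

/-- The exact volume ratio of an orthorhombic cell is the product of the axial ratios:
`(a₁ b₁ c₁)/(a₀ b₀ c₀) = (a₁/a₀)(b₁/b₀)(c₁/c₀)`.
[cite: SchillingKlotz1992, §II.B Table 2 (elementary consequence)] -/
theorem volumeRatio_eq_prod_axialRatio (a₀ b₀ c₀ a₁ b₁ c₁ : ℝ) :
    (a₁ * b₁ * c₁) / (a₀ * b₀ * c₀) = (a₁ / a₀) * (b₁ / b₀) * (c₁ / c₀) := by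
  rw [div_mul_div_comm, div_mul_div_comm]

/-- ISOTROPIC-EQUIVALENT LINEAR RATIO: for nonnegative axial ratios the cube root of the volume
ratio is at most the mean axial ratio, `(u v w)^{1/3} ≤ (u + v + w)/3` (AM–GM).
[cite: HardyLittlewoodPolya1952, §2.5 Thm 9 (chunk p0020 of the held reprint)] -/
theorem cubeRoot_volumeRatio_le_mean_axialRatio {u v w : ℝ} (hu : 0 ≤ u) (hv : 0 ≤ v)
    (hw : 0 ≤ w) : (u * v * w) ^ ((1 : ℝ) / 3) ≤ (u + v + w) / 3 := by
  have h := Real.geom_mean_le_arith_mean3_weighted (w₁ := 1 / 3) (w₂ := 1 / 3) (w₃ := 1 / 3)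
    (p₁ := u) (p₂ := v) (p₃ := w) (by norm_num) (by norm_num) (by norm_num) hu hv hw (by norm_num)
  rw [Real.mul_rpow (mul_nonneg hu hv) hw, Real.mul_rpow hu hv]
  linarith

end

end Literature.MathematicalPhysics.StatisticalMechanics
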